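import Summits.ResolutionOfSingularities.ResolutionOfSingularities.Theses.PAlteration
import Summits.ResolutionOfSingularities.ResolutionOfSingularities.Theorems.PAlterationPialtRankOneAtoms
import Summits.ResolutionOfSingularities.ResolutionOfSingularities.Theorems.PAlterationPialtTameKnownCases
import Summits.ResolutionOfSingularities.ResolutionOfSingularities.Theorems.PAlterationPialtExactness
import Summits.ResolutionOfSingularities.ResolutionOfSingularities.Theorems.PAlterationPalterationThesisPialtOfPerfect
import Summits.ResolutionOfSingularities.ResolutionOfSingularities.Theorems.PAlterationPialtKnownCases
import HarnessLib

/-!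
# Skeleton `radicially-regular-endgame` (from `SketchIdeator2`, Card A) for crux stmt-ResolutionOfSingularities-0555 `Pialt` — v5 (TEMKIN-FREE)

Line lead a2 (2026-08-16), reshaped by line lead c1 (v2/v3) and c2 (v4, 2026-08-17), re-registered by c3/c4, and
RESHAPED by line lead c5 (prover-line-stmt-ResolutionOfSingularities-0555-c5-0, 2026-08-17 — this file, v5).

`Pialt` = for every prime `p`, every integral separated `X` of finite type over a field of characteristic `p` has
a purely inseparable REGULAR alteration (Abramovich–Oort / Temkin 2013 Conj. 1.3.1 in characteristic `p`). In
tree: it suffices to treat PERFECT ground fields (`pialt_of_pialt_perfectField`) and NORMAL `X`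
(`pialt_iff_forall_normal`).

The line (idea card `Cruxes/Pialt/Ideas/radicially-regular-endgame.md`): radicially regular (RR) / locally RR
schemes; over a perfect field the crux at `X` ⟺ an RR MODIFICATION of `X` (`stub_reordering`, p107295;
`stub_normalizeRR`, p107783); the crux is cut into `TameResolution_p` and `RadicialPatching_p`, the cut is EXACT
(`pialtPerfect_iff_tame_and_patching`, p135475), and both halves are theorems modulo atoms that resolve every
variety over every perfect field (c1 squeeze p135131, descent p136512; c2 perfect-field atoms v4).

v5 RESHAPE (lead c5). v4's atoms were {`stub_temkin2013` (NAMED FACT, Temkin 2013 Thm. 1.3.2, undischarged; in-tree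
leaf `Temkin2013RelativeCurveSmoothFibre` is Berkovich-analytic), `stub_rrLU1Perfect`, `stub_twoModelPatchingPerfect`}.
Temkin's theorem was needed only because the LU atom was stated BELOW height-one Frobenius sandwiches. Stating the LU
atom on the function field itself, in Novacoski–Spivakovsky's relative form, and routing it through two theorems
PROVED in the tree — `NovacoskiSpivakovsky2014_holds` (relative LU reduces to RANK-ONE valuations) and
`relLU_at_abhyankarPlace_of_perfectField` (Knaf–Kuhlmann 2005: Abhyankar places over perfect fields are uniformizable)
— removes `Temkin2013` from the line and sharpens the LU atom to its open core
(`Theorems/PAlterationPialtRankOneAtoms.lean`, lead c5). The registered open stubs are now EXACTLY TWO, with NO named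
fact:

* `stub_relLURankOneNonAbhyankarPerfect : ∀ p prime, ∀ perfect k of char p, ∀ finitely generated K/k, every
  RANK-ONE valuation ring O ⊇ k of K that is NOT an Abhyankar place of K | k admits RELATIVE local uniformization`
  (`RelLocalUniformization k K O`, Novacoski–Spivakovsky 2014 Def. 2.20: every finitely generated model `R ⊆ O` of
  `K` is dominated inside `O` by a finitely generated model regular at the centre). Open from transcendence degree
  4 (CP2019 gives trdeg ≤ 3); a counterexample is a counterexample to local uniformization in characteristic `p`
  over a perfect field, hence to resolution in characteristic `p`. Rank one + non-Abhyankar = "rational rank +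
  residue transcendence degree < trdeg K": exactly the valuations with room for DEFECT.
* `stub_twoModelPatchingPerfect` (unchanged): Piltant 2013 Prop. 5.1 for `P = P_reg` over PERFECT ground fields
  (the perfect-field slice of the atom of crux `PatchingRel`, stmt-ResolutionOfSingularities-0642; open from trdeg 4).

EXACTNESS (kernel-checked, `forall_hasResolution_perfectField_iff_atoms`): for each perfect field `k`, (LU atom at
`k`) ∧ (patching atom at `k`) ⟺ resolution of every reduced separated `k`-scheme of finite type. So nothing registered
is stronger than resolution over perfect fields, which implies `Pialt` (`stub_pialtOfPerfect`), and closing both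
stubs now closes the crux IN THE KERNEL (v4 kept the `Temkin2013` sorry). The v4 atom `stub_rrLU1Perfect` is a
THEOREM of the v5 atom (`rrLU1Perfect_of_relLURankOneNonAbhyankarPerfect`, sandwich data idle).

Composition `Pialt_of` (unchanged): Tame gives `π : Z → X`; Patching gives the crux conclusion at `Z`; descent along
the modification `π` (`pialtShape_of_isBirational`); leave perfect fields by `stub_pialtOfPerfect` =
`pialt_of_pialt_perfectField`.
-/

set_option linter.dupNamespace false

noncomputable section

open CategoryTheory CategoryTheory.Limits AlgebraicGeometry TopologicalSpace
open Literature.AlgebraicGeometry.Resolution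
open Summit.ResolutionOfSingularities.ResolutionOfSingularities.Theses.PAlteration (Pialt Picover)

namespace Summit.ResolutionOfSingularities.ResolutionOfSingularities.Theorems.Pialt.RadiciallyRegular

/-! ## Stubs (the two atoms, perfect-field form; no named fact) -/

/-- STUB (ATOM — CRUX-SIZED, the open core of local uniformization in characteristic `p` over perfect fields):
**relative local uniformization of RANK-ONE NON-ABHYANKAR valuations over PERFECT fields.** For a perfect field `k`
of characteristic `p`, a finitely generated `K/k` and a valuation ring `O ⊇ k` of `K` of rank one which is not an
Abhyankar place of `K | k` (rational rank + residue transcendence degree < trdeg), every finitely generated `R ⊆ O`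
with `Frac R = K` is contained in a finitely generated `A ⊆ O` regular at the centre `𝔪_O ∩ A`
(Novacoski–Spivakovsky 2014, Def. 2.20). All other valuations follow: rank > 1 by `NovacoskiSpivakovsky2014_holds`,
Abhyankar places by `relLU_at_abhyankarPlace_of_perfectField` (Knaf–Kuhlmann 2005), trdeg ≤ 3 by CP2019. A
consequence of resolution in characteristic `p` (`relLURankOneNonAbhyankarPerfect_of_resolutionInChar`). -/
theorem stub_relLURankOneNonAbhyankarPerfect (p : ℕ) (hp : p.Prime) :
    ∀ (k : Type) [Field k] [CharP k p] [PerfectField k] (K : Type) [Field K] [Algebra k K]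
      (O : ValuationSubring K), (⊤ : IntermediateField k K).FG → (∀ c : k, algebraMap k K c ∈ O) →
      Nonempty O.valuation.RankOne → ¬ IsAbhyankarPlace O (algebraMap k K).fieldRange ⊤ →
      RelLocalUniformization k K O := by
  sorry

/-- STUB (ATOM — the perfect-field slice of the atom of crux `PatchingRel`, stmt-ResolutionOfSingularities-0642;
OPEN from transcendence degree 4): **Piltant's two-model patching of proper models over PERFECT ground fields** for
`P = P_reg` (Piltant 2013, Prop. 5.1): for a perfect field `k` of characteristic `p`, any two proper models of an
essentially-finite-type `K/k` are dominated by a proper model through `RegLe` morphisms. -/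
theorem stub_twoModelPatchingPerfect (p : ℕ) (hp : p.Prime) :
    ∀ (k : Type) [Field k] [CharP k p] [PerfectField k] (K : Type) [Field K] [Algebra k K]
      [Algebra.EssFiniteType k K], ∀ M₁ M₂ : ProperModel k K,
        ∃ (N : ProperModel k K) (φ₁ : N.Hom M₁) (φ₂ : N.Hom M₂), φ₁.RegLe ∧ φ₂.RegLe := by
  sorry

/-! ## The v4 LU atom and resolution over perfect fields, theorems modulo the two atoms (Temkin-free) -/

/-- The v4 atom `stub_rrLU1Perfect` (LU below height-one Frobenius sandwiches over perfect fields) is a THEOREM of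
the v5 LU atom, without `Temkin2013` (`rrLU1Perfect_of_relLURankOneNonAbhyankarPerfect`; the sandwich data are
idle: every valuation ring of `K ⊇ k` is uniformizable). Signature = the registered v4 stub. -/
theorem stub_rrLU1Perfect (p : ℕ) (hp : p.Prime) :
    ∀ (k K L : Type) [Field k] [CharP k p] [PerfectField k] [Field K] [Field L] [Algebra k K]
      [Algebra K L] [Algebra k L] [IsScalarTower k K L], (⊤ : IntermediateField k K).FG →
      IsPurelyInseparable K L →
      (∃ y : L, y ^ p ∈ (algebraMap K L).range ∧ IntermediateField.adjoin K {y} = ⊤) →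
      ∀ B : Subalgebra k L, B.FG → IsFractionRing B L → IsRegularRing B →
      ∀ O : ValuationSubring L, B.toSubring ≤ O.toSubring →
        IsLocallyUniformizable k K (O.comap (algebraMap K L)) :=
  rrLU1Perfect_of_relLURankOneNonAbhyankarPerfect (stub_relLURankOneNonAbhyankarPerfect p hp)

/-- **The two atoms resolve every reduced separated scheme of finite type over every PERFECT field of
characteristic `p`** (`hasResolution_perfectField_of_relLURankOneNonAbhyankar_of_twoModelPatchingPerfect`:
Novacoski–Spivakovsky + Knaf–Kuhlmann 2005 give relative LU of every valuation, then the Zariski–Piltant engine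
with proper models). -/
theorem hasResolutionPerfect_of_atoms (p : ℕ) (hp : p.Prime) (k : Type) [Field k] [CharP k p]
    [PerfectField k] (X : Scheme.{0}) (f : X ⟶ Spec (.of k)) [IsSeparated f]
    [LocallyOfFiniteType f] [QuasiCompact f] [IsReduced X] : Scheme.HasResolution X :=
  hasResolution_perfectField_of_relLURankOneNonAbhyankar_of_twoModelPatchingPerfect k
    (stub_relLURankOneNonAbhyankarPerfect p hp k) (stub_twoModelPatchingPerfect p hp k) X f

/-- `TameResolution_p` (formerly the open stub `stub_tameResolution`): PARTIAL RESOLUTION over a perfect field —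
every integral separated `X` of finite type has a NORMAL modification all of whose points are locally radicially
regular. From the atoms: they resolve `X` (`hasResolutionPerfect_of_atoms`) and a resolution is a tame resolution
(`stub_tameResolution_of_hasResolution`, p132170). Signature = the registered stub. -/
theorem stub_tameResolution (p : ℕ) (hp : p.Prime) (k : Type) [Field k] [CharP k p]
    [PerfectField k] (X : Scheme.{0}) (f : X ⟶ Spec (.of k)) [IsSeparated f]
    [LocallyOfFiniteType f] [QuasiCompact f] [IsIntegral X] :
    ∃ (Z : Scheme.{0}) (π : Z ⟶ X), IsProper π ∧ IsBirational π ∧ IsIntegral Z ∧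
      (∀ z : Z, IsIntegrallyClosed (Z.presheaf.stalk z)) ∧
      ∀ z : Z, ∃ U : Z.Opens, z ∈ U ∧ ∃ (W : Scheme.{0}) (h : W ⟶ (U : Scheme.{0})),
        IsIntegral W ∧ Scheme.IsRegular W ∧ IsFinite h ∧ UniversallyInjective h ∧
          Function.Surjective h.base :=
  stub_tameResolution_of_hasResolution X (hasResolutionPerfect_of_atoms p hp k X f)

/-- `RadicialPatching_p` (formerly the open stub `stub_radicialPatching`): LOCAL-TO-GLOBAL over a perfect field — a
normal integral separated LRR `Z` of finite type satisfies the conclusion of the crux. From the atoms: they resolve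
`Z` outright (`hasResolutionPerfect_of_atoms`; the LRR hypotheses are idle) and a resolution is a purely inseparable
regular alteration (`pialtConclusion_of_hasResolution`). Signature = the registered stub. -/
theorem stub_radicialPatching (p : ℕ) (hp : p.Prime) (k : Type) [Field k] [CharP k p]
    [PerfectField k] (Z : Scheme.{0}) (f : Z ⟶ Spec (.of k)) [IsSeparated f]
    [LocallyOfFiniteType f] [QuasiCompact f] [IsIntegral Z]
    (_hN : ∀ z : Z, IsIntegrallyClosed (Z.presheaf.stalk z))
    (_hL : ∀ z : Z, ∃ U : Z.Opens, z ∈ U ∧ ∃ (W : Scheme.{0}) (h : W ⟶ (U : Scheme.{0})),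
      IsIntegral W ∧ Scheme.IsRegular W ∧ IsFinite h ∧ UniversallyInjective h ∧
        Function.Surjective h.base) :
    ∃ (Z' : Scheme.{0}) (g : Z' ⟶ Z), IsProper g ∧ IsIntegral Z' ∧ Scheme.IsRegular Z' ∧
      Function.Surjective g.base ∧ ∃ U : Z.Opens, Dense (U : Set Z) ∧ IsFinite (g ∣_ U) ∧
        UniversallyInjective (g ∣_ U) :=
  pialtConclusion_of_hasResolution Z (hasResolutionPerfect_of_atoms p hp k Z f)

/-! ## Glue — LANDED (`Theorems/PAlterationPialtExactness.lean`, p135475; `Theorems/PAlterationPialtRankOneAtoms.lean`,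
lead c5): `pialtShape_of_isBirational`, `pialtPerfect_iff_tame_and_patching`, `pialt_iff_tame_and_patching`,
`pialt_iff_modRR`, and for v5 `relLU_perfectField_of_rankOne_nonAbhyankar`, `forall_hasResolution_perfectField_iff_atoms`,
`pialt_of_relLURankOneNonAbhyankarPerfect_twoModelPatchingPerfect` (the crux from the two atoms, by name). -/

/-! ## Composition -/

/-- The crux over PERFECT fields from the two halves: tame resolution `π : Z → X`, radicial patching on the normal
LRR modification `Z`, descent along `π`. -/
theorem pialtPerfect_of_stubs (p : ℕ) (hp : p.Prime) (k : Type) [Field k] [CharP k p]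
    [PerfectField k] (X : Scheme.{0}) (f : X ⟶ Spec (.of k)) [IsSeparated f]
    [LocallyOfFiniteType f] [QuasiCompact f] [IsIntegral X] :
    ∃ (X' : Scheme.{0}) (g : X' ⟶ X), IsProper g ∧ IsIntegral X' ∧ Scheme.IsRegular X' ∧
      Function.Surjective g.base ∧ ∃ U : X.Opens, Dense (U : Set X) ∧ IsFinite (g ∣_ U) ∧
        UniversallyInjective (g ∣_ U) := by
  obtain ⟨Z, π, hπ, hbir, hZ, hZn, hlrr⟩ := stub_tameResolution p hp k X f
  haveI := hπ; haveI := hZ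
  haveI : IsSeparated (π ≫ f) := inferInstance
  haveI : LocallyOfFiniteType (π ≫ f) := inferInstance
  haveI : QuasiCompact (π ≫ f) := inferInstance
  exact pialtShape_of_isBirational π hbir (stub_radicialPatching p hp k Z (π ≫ f) hZn hlrr)

/-- COMPOSITION: the crux BY NAME from the stubs (perfect fields suffice: descent from the perfect closure,
`PalterationThesis.PerfectTransfer.stub_pialtOfPerfect` = `pialt_of_pialt_perfectField`). -/
theorem Pialt_of : Pialt := by
  intro p hp k _ _ X f hs hl hq hi
  haveI : Fact p.Prime := ⟨hp⟩
  exact PalterationThesis.PerfectTransfer.stub_pialtOfPerfect p k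
    (fun Y g hs' hl' hq' hi' => by
      haveI := hs'; haveI := hl'; haveI := hq'; haveI := hi'
      exact pialtPerfect_of_stubs p hp (PerfectClosure k p) Y g) X f

/-- Sanity check (by name): the composition agrees with the landed two-atom glue. -/
example : Pialt :=
  pialt_of_relLURankOneNonAbhyankarPerfect_twoModelPatchingPerfect stub_relLURankOneNonAbhyankarPerfect
    stub_twoModelPatchingPerfect

end Summit.ResolutionOfSingularities.ResolutionOfSingularities.Theorems.Pialt.RadiciallyRegular

end
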